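import Summits.QuantumFields.YangMills.Theorems.SlowBitWindowInsertionTraceDefs
import HarnessLib

/-!
# Two-insertion zero-flux thermal traces on a ring of ARBITRARY period `n+1` — definitions

Defs module for the D-0145 LINE «QuantileBitPurity» of seat ym-idea-4 (gen 12; route onto
`ThermalTraceWindow.SubFemtoTraceRatio`, item stmt-QuantumFields-28257).  The tree's `TT.insTrace L β O m`
(`Theorems/SlowBitWindowInsertionTraceDefs.lean`) inserts a bounded observable `O` of the spatial links at slices `0`
and `m` of the closed chain of `2L` transfer kernels (temperature `1/(2L)`).  The purity-deficit line works at
temperature `1/L` — the ring of `L` kernels whose trace is `TT.physTrace L β L = Z_phys(L×L³)` — and, for the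
Hölder split of the two-time trace by levels, at a general antipode `m = ⌊L/2⌋`; so we need the same object on a
ring of `n+1` slices for every `n`:
`ringInsTrace L β n O m = ∫ (∏_{i<n} K_β(U_i,U_{i+1})) · (P K_β(U_n, ·))(U_0) · O(U_0) · O(U_m) dU`
(slot `m` read modulo `n+1`; `m = 0` inserts `O²` at slice `0`, so for an indicator `O = 𝟙_A` the value
`ringInsTrace L β n 𝟙_A 0` is the un-normalised thermal weight of the slice event `A` at temperature `1/(n+1)`).
For a gauge- and twist-invariant `O` it equals `Tr_{H_phys}(M_O (PK_βP)^m M_O (PK_βP)^{n+1-m})`.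
`n = 2L-1` is DEFINITIONALLY the tree's `insTrace` (`ringInsTrace_two_mul_sub_one`, `rfl`), and `O = 1` gives back
`physTraceSucc` (`ringInsTrace_const_one`).  Definitions + two sanity lemmas only; no summit content.
[cite: MontvayMunster1994, (3.145)] [cite: Luscher1983, §2]
-/

set_option autoImplicit false

noncomputable section

open MeasureTheory
open Literature.MathematicalPhysics.QuantumFieldTheory
open Literature.MathematicalPhysics.QuantumLattice
open scoped BigOperators

namespace Summit.QuantumFields.YangMills.Theorems.FemtoTransferGap.TT

open Summit.QuantumFields.YangMills.Theorems.FemtoTransferGap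

/-- **Two-insertion zero-flux thermal trace on a ring of `n+1` time slices**: the closed chain of `n+1` transfer
kernels of `physTraceSucc L β n` (seam `U_n → U_0` through the physical average `physAvg`) with the observable `O`
inserted at slices `0` and `m` (slot read modulo `n+1`; `m = 0` inserts `O²` at slice `0`).  For physical `O` it is
`Tr_phys(M_O (PK_β)^m M_O (PK_β)^{n+1-m})`, i.e. `Z_phys(n+1) · ⟨O(0) O(m)⟩` in the zero-flux thermal state at
temperature `1/(n+1)` on the spatial torus `(ℤ/L)³`. [cite: MontvayMunster1994, (3.145)] -/
def ringInsTrace (L : ℕ) [NeZero L] (β : ℝ) (n : ℕ) (O : GaugeConfig 3 L SU2 → ℝ) (m : ℕ) : ℝ :=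
  ∫ Us : Fin (n + 1) → GaugeConfig 3 L SU2,
    (∏ i : Fin n, transferKernel su2Rep β (Us i.castSucc) (Us i.succ)) *
      physAvg (transferKernel su2Rep β (Us (Fin.last n))) (Us 0) *
      (O (Us 0) * O (Us ⟨m % (n + 1), Nat.mod_lt _ (Nat.succ_pos _)⟩))
    ∂(Measure.pi fun _ : Fin (n + 1) => configMeasure SU2 L)

/-- The `2L`-slice ring is DEFINITIONALLY the tree's `insTrace`. -/
theorem ringInsTrace_two_mul_sub_one (L : ℕ) [NeZero L] (β : ℝ) (O : GaugeConfig 3 L SU2 → ℝ) (m : ℕ) :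
    ringInsTrace L β (2 * L - 1) O m = insTrace L β O m := rfl

/-- With the constant observable `1` the two-insertion ring trace is the zero-flux trace `physTraceSucc`. -/
theorem ringInsTrace_const_one (L : ℕ) [NeZero L] (β : ℝ) (n m : ℕ) :
    ringInsTrace L β n (fun _ => (1 : ℝ)) m = physTraceSucc L β n := by
  simp only [ringInsTrace, physTraceSucc, mul_one]

end Summit.QuantumFields.YangMills.Theorems.FemtoTransferGap.TT

end
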